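import Mathlib
import HarnessLib
import Summits.Langlands.Langlands.Theorems.SkinnerWilesDefectOneEisensteinProModularSeedEisensteinPackageQAux
import Summits.Langlands.Langlands.Theorems.SkinnerWilesDefectOneEisensteinProModularSeedRestrictTwistGaloisPackageAux2
import Literature.NumberTheory.GaloisRepresentations.DecompositionGroupOfCompletion
import Literature.NumberTheory.GaloisRepresentations.WeilGroupDensityProofs
import Literature.NumberTheory.Automorphic.AdicCompletionLocalField

/-!
# `EisensteinProModularSeed` (stmt-Langlands-12920), line `descend-raise-basechange` (v3), stub S2'
# `stub_eisensteinPackageQ` — support file II: the unit-root orientation, decomposition groups, odd frames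

Support file (`--supports stmt-Langlands-12920`) for the `ℚ`-side package of the WIDENED line (all
odd `η̄`, Billerey–Menares 2016).  Everything here is PROVED (no named fact, no definition):

* `v_unitRoot_sub_one_lt_one` — **the unit-root character is residually trivial**: for an upper
  triangular frame of a continuous `r : Γ_F → GL₂(ℚ̄_p)` (`F` a non-archimedean local field) whose
  lower-right character `δ` is `1` on inertia and equals `α ≡ 1` at the arithmetic Frobenius
  elements, `δ ≡ 1` on all of `Γ_F` (Frobenius powers, then DENSITY of the Weil group, tree theorem
  `WeilGroup.denseRange_toAbsGalois_holds`);
* `exists_absGaloisRestrict_eq_conj_of_forall_smul_mem` — an element of a decomposition group above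
  `v` is, up to `Γ_K`-conjugacy, the restriction of an element of `Γ_{K_v}` (tree:
  `decompositionSubgroup_adicCompletionPrime_eq_range`, transitivity on the primes above `v`);
* `exists_conj_involution_eq_diag` — an involution of determinant `-1` in `GL₂` over a field of
  characteristic `0` is conjugate to `diag(-1, 1)` (explicit eigenvectors); registered sub-goal alias
  `stub_eisensteinPackageQ_auxInvolution`.

References: H. Hida, *Modular Forms and Galois Cohomology* (2000), Thm. 3.26 (2) (the unit root);
J. Tate, *Number theoretic background* (Corvallis 1979), (1.4.1) (`W_F` dense in `Γ_F`);
J. Neukirch, *Algebraic Number Theory*, II (9.6). [folklore]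
-/

set_option linter.dupNamespace false -- project-wide option (lakefile weak.linter.dupNamespace); `Summit.Langlands.Langlands` is the mandated namespace

noncomputable section

namespace Summit.Langlands.Langlands.Theorems.SkinnerWilesDefectOne.EisensteinProModularSeed

open Literature.NumberTheory.GaloisRepresentations
open NumberField IsDedekindDomain IsLocalRing Field
open scoped MatrixGroups Matrix Pointwise

/-! ### The unit-root character is residually trivial -/

section UnitRoot

variable {p : ℕ} [Fact p.Prime]

/-- **The unit-root character of an ordinary frame is residually trivial when the unit root is
`≡ 1`.**  Let `F` be a non-archimedean local field, `r : Γ_F → GL₂(ℚ̄_p)` continuous and `Q` a frame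
with `Q⁻¹ r Q` upper triangular, whose lower-right entry `δ` (a continuous character) is `1` on the
inertia group `I_F` and equals `α` at every arithmetic Frobenius, with `α ≡ 1`.  Then `δ ≡ 1` on all
of `Γ_F`: every Frobenius power `σ` (Tate's `W_F`) is `τ φⁿ` with `τ ∈ I_F`, so `δ(σ) = αⁿ ≡ 1`, and
`W_F` is dense in `Γ_F` (tree theorem `WeilGroup.denseRange_toAbsGalois_holds`) while
`{v (δ - 1) < 1}` is closed. [folklore] -/
theorem v_unitRoot_sub_one_lt_one {F : Type*} [Field F] [ValuativeRel F] [TopologicalSpace F]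
    [IsNonarchimedeanLocalField F] (r : FramedRep (absoluteGaloisGroup F) (PadicAlgCl p) 2)
    (Q : GL (Fin 2) (PadicAlgCl p)) (α : PadicAlgCl p) (hα : Valued.v (α - 1) < 1)
    (h10 : ∀ σ, (Q⁻¹ * r σ * Q).val 1 0 = 0)
    (hI : ∀ σ ∈ absInertia F, (Q⁻¹ * r σ * Q).val 1 1 = 1)
    (hFrob : ∀ σ, IsAbsArithFrob σ → (Q⁻¹ * r σ * Q).val 1 1 = α) (σ : absoluteGaloisGroup F) :
    Valued.v ((Q⁻¹ * r σ * Q).val 1 1 - 1) < 1 := by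
  -- the character `δ`
  have hmul : ∀ a b : absoluteGaloisGroup F,
      (Q⁻¹ * r (a * b) * Q).val 1 1 = (Q⁻¹ * r a * Q).val 1 1 * (Q⁻¹ * r b * Q).val 1 1 := by
    intro a b
    have e : Q⁻¹ * r (a * b) * Q = (Q⁻¹ * r a * Q) * (Q⁻¹ * r b * Q) := by rw [map_mul]; group
    rw [e, Units.val_mul, Matrix.mul_apply, Fin.sum_univ_two, h10 a, zero_mul, zero_add]
  have hone : (Q⁻¹ * r 1 * Q).val 1 1 = 1 := by rw [map_one, mul_one, inv_mul_cancel]; rfl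
  set δ : absoluteGaloisGroup F →* PadicAlgCl p :=
    { toFun := fun a => (Q⁻¹ * r a * Q).val 1 1, map_one' := hone, map_mul' := hmul } with hδ
  have hδapply : ∀ a, δ a = (Q⁻¹ * r a * Q).val 1 1 := fun _ => rfl
  -- Frobenius powers
  have hW : ∀ τ : absoluteGaloisGroup F, (∃ n : ℤ, IsFrobPow τ n) → Valued.v (δ τ - 1) < 1 := by
    rintro τ ⟨n, hn⟩
    obtain ⟨φ, hφ⟩ := exists_isAbsArithFrob_holds F
    have hφ1 : IsFrobPow φ 1 := IsAbsArithFrob.isFrobPow_holds hφ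
    have hφn : IsFrobPow (φ ^ n) n := by simpa using hφ1.zpow n
    have hι : τ * (φ ^ n)⁻¹ ∈ absInertia F := IsFrobPow.mul_inv_mem_absInertia_holds hn hφn
    have e : τ = (τ * (φ ^ n)⁻¹) * φ ^ n := by group
    have h1 : δ τ = δ (φ ^ n) := by
      conv_lhs => rw [e]
      rw [map_mul, hδapply (τ * (φ ^ n)⁻¹), hI _ hι, one_mul]
    have h2 : δ (φ ^ n) = α ^ n := by
      rw [← MonoidHom.coe_toHomUnits, map_zpow, Units.val_zpow_eq_zpow_val, MonoidHom.coe_toHomUnits,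
        hδapply, hFrob φ hφ]
    rw [h1, h2]
    exact v_zpow_sub_one_lt_one hα n
  -- density of the Weil group
  have hcont : Continuous fun a => δ a := by
    have hc : Continuous fun a => ((Q⁻¹ * r a * Q : GL (Fin 2) (PadicAlgCl p)) :
        Matrix (Fin 2) (Fin 2) (PadicAlgCl p)) :=
      Units.continuous_val.comp ((continuous_const.mul (map_continuous r)).mul continuous_const)
    exact hc.matrix_elem 1 1
  set U : Set (absoluteGaloisGroup F) := (fun a => δ a - 1) ⁻¹' Metric.ball 0 1 with hU
  have hUc : IsClosed U :=
    (IsUltrametricDist.isClosed_ball (0 : PadicAlgCl p) 1).preimage (hcont.sub continuous_const)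
  have hsub : Set.range (WeilGroup.toAbsGalois F) ⊆ U := by
    rintro _ ⟨x, rfl⟩
    rw [hU, Set.mem_preimage, mem_ball_zero_iff, ← v_lt_one_iff_norm_lt_one]
    exact hW _ (WeilGroup.exists_isFrobPow_toAbsGalois IsFrobPow.mul_holds x)
  have hall : U = Set.univ := by
    apply Set.eq_univ_of_univ_subset
    rw [← (WeilGroup.denseRange_toAbsGalois_holds F).closure_eq]
    exact closure_minimal hsub hUc
  have hσ : σ ∈ U := hall ▸ Set.mem_univ σ
  rw [hU, Set.mem_preimage, mem_ball_zero_iff, ← v_lt_one_iff_norm_lt_one] at hσ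
  exact hσ

end UnitRoot

/-! ### From a decomposition group above `v` to the local Galois group -/

section Decomposition

/-- **An element of a decomposition group above `v` is conjugate to a restriction from `Γ_{K_v}`.**
If `𝔓 ∣ v` is a prime of `\bar ℤ_K` and `σ 𝔓 ⊆ 𝔓`, then `σ ∈ D_𝔓` (primes above `v` are maximal),
`𝔓 = τ 𝔓₀` for the prime `𝔓₀` of the chosen embedding `K̄ → \bar K_v` (transitivity), and
`τ⁻¹ σ τ ∈ D_{𝔓₀} = res(Γ_{K_v})` (tree: `decompositionSubgroup_adicCompletionPrime_eq_range`,
Neukirch II (9.6)). [folklore] -/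
theorem exists_absGaloisRestrict_eq_conj_of_forall_smul_mem {K : Type*} [Field K] [NumberField K]
    (v : HeightOneSpectrum (𝓞 K)) {𝔓 : Ideal (absIntegers (𝓞 K) K)} (h𝔓 : 𝔓 ∈ v.primesAbove)
    {σ : absoluteGaloisGroup K} (hσ : ∀ x ∈ 𝔓, σ • x ∈ 𝔓) :
    ∃ (τ : absoluteGaloisGroup K) (σ₀ : absoluteGaloisGroup (v.adicCompletion K)),
      absGaloisRestrict K (v.adicCompletion K) σ₀ = τ⁻¹ * σ * τ := by
  have hle : σ • 𝔓 ≤ 𝔓 := by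
    intro x hx
    rw [Ideal.mem_pointwise_smul_iff_inv_smul_mem] at hx
    have := hσ _ hx
    rwa [smul_inv_smul] at this
  have hmax : 𝔓.IsMaximal := HeightOneSpectrum.isMaximal_of_mem_primesAbove h𝔓
  have h𝔓' : σ • 𝔓 ∈ v.primesAbove := by
    rw [HeightOneSpectrum.mem_primesAbove_iff] at h𝔓 ⊢
    obtain ⟨h1, h2⟩ := h𝔓
    exact ⟨Ideal.IsPrime.smul σ, Ideal.LiesOver.smul σ⟩
  have heq : σ • 𝔓 = 𝔓 :=
    (HeightOneSpectrum.isMaximal_of_mem_primesAbove h𝔓').eq_of_le hmax.ne_top hle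
  obtain ⟨τ, hτ⟩ := HeightOneSpectrum.exists_smul_eq_of_mem_primesAbove_holds
    (adicCompletionPrime_mem_primesAbove K v) h𝔓
  have hD : σ ∈ (τ • adicCompletionPrime K v).decompositionSubgroup (absoluteGaloisGroup K) := by
    rw [hτ]; exact Ideal.mem_decompositionSubgroup_iff.mpr heq
  have h3 := RestrictTwist.mem_decompositionSubgroup_of_smul K hD
  rw [decompositionSubgroup_adicCompletionPrime_eq_range] at h3
  obtain ⟨σ₀, hσ₀⟩ := h3
  exact ⟨τ, σ₀, hσ₀⟩

end Decomposition

/-! ### Odd two-dimensional representations: the eigenframe of complex conjugation -/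

section Involution

variable {A : Type*} [Field A]

/-- `(R⁻¹ M R) = D` from `M R = R D`. [folklore] -/
theorem units_conj_val_eq {n : Type*} [Fintype n] [DecidableEq n] (R M : GL n A) (D : Matrix n n A)
    (h : M.val * R.val = R.val * D) : (R⁻¹ * M * R).val = D := by
  rw [Units.val_mul, Units.val_mul, Matrix.mul_assoc, h, ← Matrix.mul_assoc, Units.inv_mul,
    Matrix.one_mul]

/-- **An involution of determinant `-1` in `GL₂` over a field of characteristic `0` is conjugate to
`diag(-1, 1)`**: the columns `(M - 1) e` and `(M + 1) e` of a suitable coordinate vector `e` are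
eigenvectors for `-1` and `1`. [folklore] -/
theorem exists_conj_involution_eq_diag [CharZero A] (M : GL (Fin 2) A) (hM : M * M = 1)
    (hdet : M.val.det = -1) :
    ∃ R : GL (Fin 2) A, (R⁻¹ * M * R).val = !![-1, 0; 0, 1] := by
  classical
  set a := M.val 0 0 with ha
  set b := M.val 0 1 with hb
  set c := M.val 1 0 with hc
  set d := M.val 1 1 with hd
  have hMv : M.val = !![a, b; c, d] := Matrix.eta_fin_two _
  have hsq : !![a, b; c, d] * !![a, b; c, d] = 1 := by rw [← hMv, ← Units.val_mul, hM, Units.val_one]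
  rw [Matrix.mul_fin_two] at hsq
  have e00 : a * a + b * c = 1 := by
    have := congrArg (fun N : Matrix (Fin 2) (Fin 2) A => N 0 0) hsq; simpa using this
  have e01 : a * b + b * d = 0 := by
    have := congrArg (fun N : Matrix (Fin 2) (Fin 2) A => N 0 1) hsq; simpa using this
  have e10 : c * a + d * c = 0 := by
    have := congrArg (fun N : Matrix (Fin 2) (Fin 2) A => N 1 0) hsq; simpa using this
  have e11 : c * b + d * d = 1 := by
    have := congrArg (fun N : Matrix (Fin 2) (Fin 2) A => N 1 1) hsq; simpa using this
  have hdet' : a * d - b * c = -1 := by rw [hMv, Matrix.det_fin_two_of] at hdet; exact hdet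
  have h2 : (2 : A) ≠ 0 := two_ne_zero
  by_cases hc0 : c ≠ 0
  · -- eigenvectors `(a - 1, c)` and `(a + 1, c)`
    have hR : (!![a - 1, a + 1; c, c] : Matrix (Fin 2) (Fin 2) A).det ≠ 0 := by
      rw [Matrix.det_fin_two_of]
      have : (a - 1) * c - (a + 1) * c = -2 * c := by ring
      rw [this]
      exact mul_ne_zero (neg_ne_zero.mpr h2) hc0
    refine ⟨Matrix.GeneralLinearGroup.mkOfDetNeZero _ hR, units_conj_val_eq _ _ _ ?_⟩
    change M.val * !![a - 1, a + 1; c, c] = !![a - 1, a + 1; c, c] * !![-1, 0; 0, 1]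
    rw [hMv, Matrix.mul_fin_two, Matrix.mul_fin_two]
    ext i j; fin_cases i <;> fin_cases j <;> simp
    · linear_combination e00
    · linear_combination e00
    · linear_combination e10
    · linear_combination e10
  push Not at hc0
  by_cases hb0 : b ≠ 0
  · -- eigenvectors `(b, d - 1)` and `(b, d + 1)`
    have hR : (!![b, b; d - 1, d + 1] : Matrix (Fin 2) (Fin 2) A).det ≠ 0 := by
      rw [Matrix.det_fin_two_of]
      have : b * (d + 1) - b * (d - 1) = 2 * b := by ring
      rw [this]
      exact mul_ne_zero h2 hb0
    refine ⟨Matrix.GeneralLinearGroup.mkOfDetNeZero _ hR, units_conj_val_eq _ _ _ ?_⟩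
    change M.val * !![b, b; d - 1, d + 1] = !![b, b; d - 1, d + 1] * !![-1, 0; 0, 1]
    rw [hMv, Matrix.mul_fin_two, Matrix.mul_fin_two]
    rw [hc0] at e11
    ext i j; fin_cases i <;> fin_cases j <;> simp [hc0]
    · linear_combination e01
    · linear_combination e01
    · linear_combination e11
    · linear_combination e11
  push Not at hb0
  -- `M` is diagonal with `a² = d² = 1`, `a d = -1`
  rw [hb0, hc0, mul_zero, sub_zero] at hdet'
  rw [hb0, hc0, mul_zero, add_zero] at e00
  rcases mul_self_eq_one_iff.mp e00 with ha1 | ha1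
  · -- `a = 1`, `d = -1`: swap the basis
    have hd1 : d = -1 := by rw [ha1, one_mul] at hdet'; exact hdet'
    have hR : (!![0, 1; 1, 0] : Matrix (Fin 2) (Fin 2) A).det ≠ 0 := by
      rw [Matrix.det_fin_two_of]; norm_num
    refine ⟨Matrix.GeneralLinearGroup.mkOfDetNeZero _ hR, units_conj_val_eq _ _ _ ?_⟩
    change M.val * !![0, 1; 1, 0] = !![0, 1; 1, 0] * !![-1, 0; 0, 1]
    rw [hMv, hb0, hc0, ha1, hd1, Matrix.mul_fin_two, Matrix.mul_fin_two]
    ext i j; fin_cases i <;> fin_cases j <;> simp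
  · -- `a = -1`, `d = 1`: nothing to do
    have hd1 : d = 1 := by rw [ha1] at hdet'; linear_combination -hdet'
    refine ⟨1, ?_⟩
    rw [inv_one, one_mul, mul_one, hMv, hb0, hc0, ha1, hd1]

end Involution

/-! ### Registered sub-goal -/

section Alias

/-- **Registered sub-goal of `stub_eisensteinPackageQ` (support file II): the eigenframe of an
involution of determinant `-1`** (= `exists_conj_involution_eq_diag`, explicit binders). [folklore] -/
theorem stub_eisensteinPackageQ_auxInvolution :
    ∀ (A : Type) [Field A] [CharZero A] (M : Matrix.GeneralLinearGroup (Fin 2) A), M * M = 1 → M.val.det = -1 →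
      ∃ R : Matrix.GeneralLinearGroup (Fin 2) A, (R⁻¹ * M * R).val = !![-1, 0; 0, 1] :=
  fun _ _ _ M hM hdet => exists_conj_involution_eq_diag M hM hdet

end Alias

end Summit.Langlands.Langlands.Theorems.SkinnerWilesDefectOne.EisensteinProModularSeed
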